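import Mathlib
import Summits.Ventures.PercRepro2.CoinChainScChain
import Summits.Ventures.PercRepro2.CoinChainEnteredPart

/-!
# (Q′) from (SC): the algebra and the chain lemmas (blind cell PercRepro2, night-2 g24;
proofs/NIGHT2-DARC.md §64)

`qprime_of_sc_alg`: with `Iₚ, Dₚ` the ideal and entered parts of `U111`, `r, g` the entered masses
of the `R`-law and the gate (`P₀ = r − g`), the gate-only inequality `r Dₚ + g Iₚ ≥ 0`, the ideal
FKG bound `(m b1 − b0 xI)(m b2 − b0 yI) ≤ m Iₚ`, the CLOSED-GATE one-marker bounds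
`r (b0 a − a0 b) ≤ a0 (m b − b0 (·)I)` and the ideal means below the world-0 and world-1 means give
`a0² (Iₚ + Dₚ) + (r − g) Δ ≥ 0` — (Q′).  In the anti-aligned pattern `E < 0 < E'`:
`m (−E) ≤ a0 (m b1 − b0 xI)` and `r E' ≤ a0 (m b2 − b0 yI)` give `r (−E) E' ≤ a0² Iₚ`, and (SC) gives
`r a0² (Iₚ + Dₚ) ≥ (r − g) a0² Iₚ`; so `r · (Q′) ≥ (r − g)(a0² Iₚ − r(−E)E') ≥ 0`.

`chain_closed_om` (`q₀ ≤ q_{rD}` through the global tilt `ν d`), `chain_ideal_fkg` (FKG on the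
ideal) and `chain_entered_gate_zero` (no entered `R`-mass, no entered gate part) are the chain
facts the assembly `pureChain_Qprime` (`CoinChainScQprime`) needs.
-/

namespace Summit.Ventures.PercRepro2.Coin

open Classical

section QprimeAlg

variable {R : Type*} [Field R] [LinearOrder R] [IsStrictOrderedRing R]

/-- (Q′) from (SC): the algebra.  `Ip`, `Dp` the ideal and entered parts of `U111`; `r, g` the
entered masses of the `R`-law and the gate (`P₀ = r − g`); `hSC` the gate-only inequality;
`hIp` the ideal FKG bound; `hOMx`/`hOMy` the CLOSED-GATE one-marker bounds; `hidx`/`hidy` the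
ideal means below the world-0 means; `hqx`/`hqy` below the world-1 means; `hDp0`: no entered
`R`-mass, no entered gate part. -/
lemma qprime_of_sc_alg (a0 a1 a2 b0 b1 b2 m xI yI Ip Dp r g : R)
    (hm : 0 < m) (ha0 : 0 ≤ a0) (hb0 : 0 ≤ b0) (hr0 : 0 ≤ r) (hgr : g ≤ r) (hg0 : 0 ≤ g)
    (hSC : 0 ≤ r * Dp + g * Ip) (hDp0 : r = 0 → Dp = 0)
    (hIp : (m * b1 - b0 * xI) * (m * b2 - b0 * yI) ≤ m * Ip)
    (hOMx : r * (b0 * a1 - a0 * b1) ≤ a0 * (m * b1 - b0 * xI))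
    (hOMy : r * (b0 * a2 - a0 * b2) ≤ a0 * (m * b2 - b0 * yI))
    (hidx : a0 * xI ≤ m * a1) (hidy : a0 * yI ≤ m * a2)
    (hqx : b0 * xI ≤ m * b1) (hqy : b0 * yI ≤ m * b2) :
    0 ≤ a0 ^ 2 * (Ip + Dp) + (r - g) * ((b0 * a1 - a0 * b1) * (b0 * a2 - a0 * b2)) := by
  have hx1 : 0 ≤ m * b1 - b0 * xI := by linarith
  have hy1 : 0 ≤ m * b2 - b0 * yI := by linarith
  have hprod : 0 ≤ (m * b1 - b0 * xI) * (m * b2 - b0 * yI) := mul_nonneg hx1 hy1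
  have hIp0 : 0 ≤ Ip := (mul_nonneg_iff_of_pos_left hm).mp (le_trans hprod hIp)
  have hA2 : 0 ≤ a0 ^ 2 := sq_nonneg a0
  have hP : 0 ≤ r - g := by linarith
  -- the degenerate case: no entered `R`-mass
  rcases eq_or_lt_of_le hr0 with hrz | hrpos
  · have hgz : g = 0 := le_antisymm (by rw [← hrz] at hgr; exact hgr) hg0
    rw [hDp0 hrz.symm, ← hrz, hgz]
    have : 0 ≤ a0 ^ 2 * (Ip + 0) := mul_nonneg hA2 (by linarith)
    linarith
  -- `r (−E) E' ≤ a0² Ip` in the pattern `E < 0 < E'`, and its mirror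
  have hE1 : m * (-(b0 * a1 - a0 * b1)) ≤ a0 * (m * b1 - b0 * xI) := by
    have h := mul_le_mul_of_nonneg_left hidx hb0
    have e : a0 * (m * b1 - b0 * xI) - m * (-(b0 * a1 - a0 * b1)) = b0 * (m * a1) - b0 * (a0 * xI) := by
      ring
    linarith [h, e]
  have hE2 : m * (-(b0 * a2 - a0 * b2)) ≤ a0 * (m * b2 - b0 * yI) := by
    have h := mul_le_mul_of_nonneg_left hidy hb0
    have e : a0 * (m * b2 - b0 * yI) - m * (-(b0 * a2 - a0 * b2)) = b0 * (m * a2) - b0 * (a0 * yI) := by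
      ring
    linarith [h, e]
  have hmIp : a0 * (m * b1 - b0 * xI) * (a0 * (m * b2 - b0 * yI)) ≤ a0 ^ 2 * (m * Ip) := by
    have e : a0 * (m * b1 - b0 * xI) * (a0 * (m * b2 - b0 * yI)) =
        a0 ^ 2 * ((m * b1 - b0 * xI) * (m * b2 - b0 * yI)) := by ring
    rw [e]; exact mul_le_mul_of_nonneg_left hIp hA2
  set E := b0 * a1 - a0 * b1 with hE
  set E' := b0 * a2 - a0 * b2 with hE'
  -- (SC) in the form `(r − g) a0² Ip ≤ r a0² (Ip + Dp)`
  have hSC' : (r - g) * (a0 ^ 2 * Ip) ≤ r * (a0 ^ 2 * (Ip + Dp)) := by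
    have h := mul_nonneg hA2 hSC
    have e : r * (a0 ^ 2 * (Ip + Dp)) - (r - g) * (a0 ^ 2 * Ip) = a0 ^ 2 * (r * Dp + g * Ip) := by ring
    linarith [h, e]
  -- `r · target ≥ 0`
  have key : 0 ≤ r * (a0 ^ 2 * (Ip + Dp) + (r - g) * (E * E')) := by
    rcases le_or_gt 0 (E * E') with hEE | hEE
    · have h1 : 0 ≤ r * ((r - g) * (E * E')) := mul_nonneg hr0 (mul_nonneg hP hEE)
      have h2 : 0 ≤ (r - g) * (a0 ^ 2 * Ip) := mul_nonneg hP (mul_nonneg hA2 hIp0)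
      have e : r * (a0 ^ 2 * (Ip + Dp) + (r - g) * (E * E')) =
          r * (a0 ^ 2 * (Ip + Dp)) + r * ((r - g) * (E * E')) := by ring
      rw [e]; exact add_nonneg (le_trans h2 hSC') h1
    · -- anti-aligned: `r (−E E') ≤ a0² Ip`
      have hneed : r * (-(E * E')) ≤ a0 ^ 2 * Ip := by
        rcases lt_or_ge E 0 with hEneg | hEpos
        · have hE'pos : 0 < E' := by
            by_contra hcon
            exact absurd (mul_nonneg_of_nonpos_of_nonpos hEneg.le (not_lt.mp hcon)) (not_le.mpr hEE)
          have h3 : (m * (-E)) * (r * E') ≤ (a0 * (m * b1 - b0 * xI)) * (a0 * (m * b2 - b0 * yI)) :=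
            mul_le_mul hE1 hOMy (mul_nonneg hr0 hE'pos.le) (mul_nonneg ha0 hx1)
          have h4 : m * (r * (-(E * E'))) ≤ m * (a0 ^ 2 * Ip) := by
            calc m * (r * (-(E * E'))) = (m * (-E)) * (r * E') := by ring
              _ ≤ (a0 * (m * b1 - b0 * xI)) * (a0 * (m * b2 - b0 * yI)) := h3
              _ ≤ a0 ^ 2 * (m * Ip) := hmIp
              _ = m * (a0 ^ 2 * Ip) := by ring
          exact le_of_mul_le_mul_left h4 hm
        · have hE'neg : E' < 0 := by
            by_contra hcon
            exact absurd (mul_nonneg hEpos (not_lt.mp hcon)) (not_le.mpr hEE)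
          have h3 : (m * (-E')) * (r * E) ≤ (a0 * (m * b2 - b0 * yI)) * (a0 * (m * b1 - b0 * xI)) :=
            mul_le_mul hE2 hOMx (mul_nonneg hr0 hEpos) (mul_nonneg ha0 hy1)
          have h4 : m * (r * (-(E * E'))) ≤ m * (a0 ^ 2 * Ip) := by
            calc m * (r * (-(E * E'))) = (m * (-E')) * (r * E) := by ring
              _ ≤ (a0 * (m * b2 - b0 * yI)) * (a0 * (m * b1 - b0 * xI)) := h3
              _ = a0 * (m * b1 - b0 * xI) * (a0 * (m * b2 - b0 * yI)) := by ring
              _ ≤ a0 ^ 2 * (m * Ip) := hmIp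
              _ = m * (a0 ^ 2 * Ip) := by ring
          exact le_of_mul_le_mul_left h4 hm
      have h5 := mul_le_mul_of_nonneg_left hneed hP
      have e : r * (a0 ^ 2 * (Ip + Dp) + (r - g) * (E * E')) =
          r * (a0 ^ 2 * (Ip + Dp)) - (r - g) * (r * (-(E * E'))) := by ring
      rw [e]; linarith [h5, hSC']
  exact (mul_nonneg_iff_of_pos_left hrpos).mp key

end QprimeAlg


section QprimeLemmas

variable {V : Type*} [DecidableEq V] {R : Type*} [Field R] [LinearOrder R] [IsStrictOrderedRing R]

/-- **The closed-gate one-marker bound**: the world-0 mean is below the world-1 mean on the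
entered clusters, `q₀ ≤ q_{rD}`, in cleared form `(zI + zM) r ≤ (m + M) zr` — through the global
tilt `ν d` (`mean_le_tilt`, `tilt_upset_mean`). -/
theorem chain_closed_om (U ent' : Finset V) (ν c d : Finset V → R)
    (hν0 : ∀ W, 0 ≤ ν W) (hν : ∀ s ⊆ U, ∀ t ⊆ U, ν s * ν t ≤ ν (s ∩ t) * ν (s ∪ t))
    (hc0 : ∀ W, 0 ≤ c W) (hd0 : ∀ W, 0 ≤ d W)
    (hdd : ∀ s t, d s * d t ≤ d (s ∩ t) * d (s ∪ t))
    (hcd : ∀ s t, c s * d t ≤ c (s ∩ t) * d (s ∪ t))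
    (z : Finset V → R) (hz0 : ∀ W, 0 ≤ z W) (hzm : ∀ s t, z s ≤ z (s ∪ t)) :
    ((∑ W ∈ U.powerset.filter (fun W => ¬ ∃ r ∈ ent', r ∈ W), ν W * c W * z W) +
        (∑ W ∈ U.powerset.filter (fun W => ∃ r ∈ ent', r ∈ W), ν W * c W * z W)) *
      (∑ W ∈ U.powerset.filter (fun W => ∃ r ∈ ent', r ∈ W), ν W * d W) ≤
    ((∑ W ∈ U.powerset.filter (fun W => ¬ ∃ r ∈ ent', r ∈ W), ν W * c W) +
        (∑ W ∈ U.powerset.filter (fun W => ∃ r ∈ ent', r ∈ W), ν W * c W)) *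
      (∑ W ∈ U.powerset.filter (fun W => ∃ r ∈ ent', r ∈ W), ν W * d W * z W) := by
  have hsplit : ∀ f : Finset V → R, (∑ W ∈ U.powerset, f W) =
      (∑ W ∈ U.powerset.filter (fun W => ¬ ∃ r ∈ ent', r ∈ W), f W) +
        (∑ W ∈ U.powerset.filter (fun W => ∃ r ∈ ent', r ∈ W), f W) := by
    intro f; rw [add_comm, Finset.sum_filter_add_sum_filter_not]
  have h1 := mean_le_tilt U ν c d z hν0 hν hc0 hd0 hcd hz0 hzm
  have h2 := tilt_upset_mean U ent' ν d z hν0 hν hd0 hdd hz0 hzm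
  rw [hsplit (fun W => ν W * c W * z W), hsplit (fun W => ν W * c W)] at h1
  set mM := (∑ W ∈ U.powerset.filter (fun W => ¬ ∃ r ∈ ent', r ∈ W), ν W * c W) +
    (∑ W ∈ U.powerset.filter (fun W => ∃ r ∈ ent', r ∈ W), ν W * c W) with hmM
  set zz := (∑ W ∈ U.powerset.filter (fun W => ¬ ∃ r ∈ ent', r ∈ W), ν W * c W * z W) +
    (∑ W ∈ U.powerset.filter (fun W => ∃ r ∈ ent', r ∈ W), ν W * c W * z W) with hzz
  set r := ∑ W ∈ U.powerset.filter (fun W => ∃ r ∈ ent', r ∈ W), ν W * d W with hr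
  set zr := ∑ W ∈ U.powerset.filter (fun W => ∃ r ∈ ent', r ∈ W), ν W * d W * z W with hzr
  set D := ∑ W ∈ U.powerset, ν W * d W with hDdef
  set Dz := ∑ W ∈ U.powerset, ν W * d W * z W with hDzdef
  have hD0 : 0 ≤ D := Finset.sum_nonneg fun W _ => mul_nonneg (hν0 W) (hd0 W)
  have hr0 : 0 ≤ r := Finset.sum_nonneg fun W _ => mul_nonneg (hν0 W) (hd0 W)
  have hmM0 : 0 ≤ mM := add_nonneg (Finset.sum_nonneg fun W _ => mul_nonneg (hν0 W) (hc0 W))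
    (Finset.sum_nonneg fun W _ => mul_nonneg (hν0 W) (hc0 W))
  -- h1 : zz * D ≤ mM * Dz ;  h2 : Dz * r ≤ D * zr
  have hchain : D * (zz * r) ≤ D * (mM * zr) := by
    have e1 := mul_le_mul_of_nonneg_right h1 hr0
    have e2 := mul_le_mul_of_nonneg_left h2 hmM0
    calc D * (zz * r) = (zz * D) * r := by ring
      _ ≤ (mM * Dz) * r := e1
      _ = mM * (Dz * r) := by ring
      _ ≤ mM * (D * zr) := e2
      _ = D * (mM * zr) := by ring
  rcases eq_or_lt_of_le hD0 with hDz | hDpos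
  · have hterm : ∀ W ∈ U.powerset, ν W * d W = 0 := by
      intro W hW
      exact (Finset.sum_eq_zero_iff_of_nonneg (fun W _ => mul_nonneg (hν0 W) (hd0 W))).1
        hDz.symm W hW
    have hr_zero : r = 0 := by
      rw [hr]
      exact Finset.sum_eq_zero fun W hW => hterm W (Finset.mem_filter.1 hW).1
    have hzr_zero : zr = 0 := by
      rw [hzr]
      exact Finset.sum_eq_zero fun W hW => by rw [hterm W (Finset.mem_filter.1 hW).1, zero_mul]
    rw [hr_zero, hzr_zero]; simp
  · exact le_of_mul_le_mul_left hchain hDpos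

/-- **FKG on the ideal** (a sublattice): `(∑_I ν c x)(∑_I ν c y) ≤ (∑_I ν c)(∑_I ν c x y)`. -/
theorem chain_ideal_fkg (U ent' : Finset V) (ν c : Finset V → R)
    (hν0 : ∀ W, 0 ≤ ν W) (hν : ∀ s ⊆ U, ∀ t ⊆ U, ν s * ν t ≤ ν (s ∩ t) * ν (s ∪ t))
    (hc0 : ∀ W, 0 ≤ c W) (hcc : ∀ s t, c s * c t ≤ c (s ∩ t) * c (s ∪ t))
    (x y : Finset V → R) (hx0 : ∀ W, 0 ≤ x W) (hy0 : ∀ W, 0 ≤ y W)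
    (hxm : ∀ s t, x s ≤ x (s ∪ t)) (hym : ∀ s t, y s ≤ y (s ∪ t)) :
    (∑ W ∈ U.powerset.filter (fun W => ¬ ∃ r ∈ ent', r ∈ W), ν W * c W * x W) *
        (∑ W ∈ U.powerset.filter (fun W => ¬ ∃ r ∈ ent', r ∈ W), ν W * c W * y W) ≤
      (∑ W ∈ U.powerset.filter (fun W => ¬ ∃ r ∈ ent', r ∈ W), ν W * c W) *
        (∑ W ∈ U.powerset.filter (fun W => ¬ ∃ r ∈ ent', r ∈ W), ν W * c W * (x W * y W)) := by
  have hL₀0 : ∀ W, 0 ≤ ν W * c W := fun W => mul_nonneg (hν0 W) (hc0 W)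
  simp only [Finset.sum_filter]
  have n₁ : ∀ W, (0 : R) ≤ (if ¬ ∃ r ∈ ent', r ∈ W then ν W * c W * x W else 0) := fun W => by
    split_ifs <;> first | exact le_rfl | exact mul_nonneg (hL₀0 W) (hx0 W)
  have n₂ : ∀ W, (0 : R) ≤ (if ¬ ∃ r ∈ ent', r ∈ W then ν W * c W * y W else 0) := fun W => by
    split_ifs <;> first | exact le_rfl | exact mul_nonneg (hL₀0 W) (hy0 W)
  have n₃ : ∀ W, (0 : R) ≤ (if ¬ ∃ r ∈ ent', r ∈ W then ν W * c W else 0) := fun W => by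
    split_ifs <;> first | exact le_rfl | exact hL₀0 W
  have n₄ : ∀ W, (0 : R) ≤ (if ¬ ∃ r ∈ ent', r ∈ W then ν W * c W * (x W * y W) else 0) :=
    fun W => by
      split_ifs <;> first | exact le_rfl | exact mul_nonneg (hL₀0 W) (mul_nonneg (hx0 W) (hy0 W))
  refine ad_pointwise U _ _ _ _ n₁ n₂ n₃ n₄ ?_
  intro s hs t ht
  by_cases h1 : ¬ ∃ r ∈ ent', r ∈ s
  · by_cases h2 : ¬ ∃ r ∈ ent', r ∈ t
    · have h3 : ¬ ∃ r ∈ ent', r ∈ s ∩ t := by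
        rintro ⟨r', hr', hrst⟩; exact h1 ⟨r', hr', (Finset.mem_inter.1 hrst).1⟩
      have h4 : ¬ ∃ r ∈ ent', r ∈ s ∪ t := by
        rintro ⟨r', hr', hrst⟩
        rcases Finset.mem_union.1 hrst with hs' | ht'
        · exact h1 ⟨r', hr', hs'⟩
        · exact h2 ⟨r', hr', ht'⟩
      rw [if_pos h1, if_pos h2, if_pos h3, if_pos h4]
      have e1 : ν s * ν t ≤ ν (s ∩ t) * ν (s ∪ t) := hν s hs t ht
      have e2 := hcc s t
      have e3 := hxm s t
      have e4 : y t ≤ y (s ∪ t) := by rw [Finset.union_comm]; exact hym t s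
      calc ν s * c s * x s * (ν t * c t * y t)
          = (ν s * ν t) * (c s * c t) * (x s * y t) := by ring
        _ ≤ (ν (s ∩ t) * ν (s ∪ t)) * (c (s ∩ t) * c (s ∪ t)) * (x (s ∪ t) * y (s ∪ t)) := by
            apply mul_le_mul (mul_le_mul e1 e2 (mul_nonneg (hc0 _) (hc0 _))
              (mul_nonneg (hν0 _) (hν0 _)))
              (mul_le_mul e3 e4 (hy0 _) (hx0 _)) (mul_nonneg (hx0 _) (hy0 _))
              (mul_nonneg (mul_nonneg (hν0 _) (hν0 _)) (mul_nonneg (hc0 _) (hc0 _)))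
        _ = ν (s ∩ t) * c (s ∩ t) * (ν (s ∪ t) * c (s ∪ t) * (x (s ∪ t) * y (s ∪ t))) := by ring
    · rw [if_neg h2, mul_zero]; exact mul_nonneg (n₃ _) (n₄ _)
  · rw [if_neg h1, zero_mul]; exact mul_nonneg (n₃ _) (n₄ _)

/-- No entered `R`-mass, no entered gate part: `∑_D ν d = 0 → ∑_D ν d' h = 0`. -/
theorem chain_entered_gate_zero (U ent' : Finset V) (ν d d' : Finset V → R)
    (hν0 : ∀ W, 0 ≤ ν W) (hd0 : ∀ W, 0 ≤ d W) (hd'0 : ∀ W, 0 ≤ d' W) (hd'd : ∀ W, d' W ≤ d W)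
    (h : Finset V → R)
    (hrz : (∑ W ∈ U.powerset.filter (fun W => ∃ r ∈ ent', r ∈ W), ν W * d W) = 0) :
    (∑ W ∈ U.powerset.filter (fun W => ∃ r ∈ ent', r ∈ W), ν W * d' W * h W) = 0 := by
  have hterm : ∀ W ∈ U.powerset.filter (fun W => ∃ r ∈ ent', r ∈ W), ν W * d W = 0 :=
    (Finset.sum_eq_zero_iff_of_nonneg (fun W _ => mul_nonneg (hν0 W) (hd0 W))).1 hrz
  refine Finset.sum_eq_zero fun W hW => ?_
  have h1 : ν W * d' W ≤ ν W * d W := mul_le_mul_of_nonneg_left (hd'd W) (hν0 W)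
  have h2 : 0 ≤ ν W * d' W := mul_nonneg (hν0 W) (hd'0 W)
  have h3 : ν W * d' W = 0 := le_antisymm (by rw [← hterm W hW]; exact h1) h2
  rw [h3, zero_mul]

end QprimeLemmas


end Summit.Ventures.PercRepro2.Coin
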